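import Summits.HodgeConjecture.CorCM.MultiFieldWeilTwinUnits
import Summits.HodgeConjecture.CorCM.MultiFieldWeilNonIsomorphicFamilies
import HarnessLib

/-!
# MULTI-FIELD WEIL ENGINE — TWIN UNITS, REALISED: the Hodge conjecture for every product of copies of a family with a TWIN PAIR of slots (two types of one field read in ONE
# frame), given the single-slot Weil spaces (frame form)

Cell `pub-hodgecm2` (COR-CM), seat b30 gen 37 (2026-08-25); count-neutral own lane MULTI-FIELD WEIL ENGINE (stem `MultiFieldWeil*`), sequel of `CorCM/MultiFieldWeilTwinUnits.lean`
(T1, census) in the pattern of V2 `CorCM/MultiFieldWeilNonIsomorphicFamilies.lean`.  Theorems only; no definition, no named fact, no `sorry`.  HONEST FRAMING: conditional on the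
displayed single-slot Weil-space binders `hW m`; `HC_CM` is NOT proved and not asserted.

* §1 `exists_hasDefectsG_realisedTuples_of_twin` — T1's defect law `exists_hasDefectsG_of_twinStabiliserTransitive` for the realised tuples (closed, non-empty, transitive on
  every slot BY NAME: `mul_mem_realisedTuples`, `inv_mem_realisedTuples`, `realisedTuples_nonempty`, `transitive_realisedTuples`).
* §2 **`hodgeConjectureFor_biproduct_comp_of_twin_frames`** — THE HEADLINE (frame form): `k = Kf i₀` imaginary quadratic, `E = A 0 ⊨ (k; {τ})`, `B_m = A (m+1) ⊨ (K_m; Φ (m+1))`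
  over CM fields `K_m ⊇ i_m(k)` of PRIME relative degrees `n_m`, types read by frames `e m` at position sets `P m`; a TWIN PAIR of slots `m₁ ≠ m₂` (one size `≥ 3`, realised tuples
  DIAGONAL on the pair, `2`-transitive at `m₁`, singleton position sets `{p₁} ≠ {p₂}`); realised tuples trivial on a unit transitive on every slot of another unit.  Then the
  Hodge conjecture holds for EVERY product of copies `⨁_j A(κ j)`, GIVEN the single-slot Weil spaces (`hodgeConjectureFor_biproduct_comp_of_defectLawG` with §1 as the defect
  law).  The sextic reading (twin slots = two primitive types of one non-Galois `k·F⁺`, gen 14's dihedral frame; other slots over non-isomorphic sextic fields through `k`,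
  Markman's fourfold theorem for every `hW m`) is the sequel.
[cite: Pohlmann1968, Thm 1] [cite: MoonenZarhin1995Duke, Thm. 2.4] [cite: Milne2020HodgeClassesAV, 1.2 (a) and Thm. 1] [cite: DixonMortimer1996, §1.6 and Thm. 1.6A; §2.1]
[cite: Shimura1998, §18.2 Lemma (i)]

## References
* [Pohlmann1968] H. Pohlmann, Ann. of Math. 88 (1968), Thm 1.  [MoonenZarhin1995Duke] B. Moonen, Yu. Zarhin, Duke Math. J. 77 (1995), Thm. 2.4.  [Milne2020HodgeClassesAV]
  J. S. Milne, arXiv:2010.08857, 1.2 (a), Thm. 1.  [DixonMortimer1996] J. D. Dixon, B. Mortimer, *Permutation Groups*, GTM 163.  [Shimura1998] G. Shimura, CM book, §18.2.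
-/

noncomputable section

open CategoryTheory CategoryTheory.Limits NumberField IntermediateField

namespace Summit.HodgeConjecture.CorCM.MultiFieldWeil

open Finset
open Literature.AlgebraicGeometry Literature.AlgebraicGeometry.Motives Literature.AlgebraicGeometry.HodgeTheory
open Literature.AlgebraicGeometry.ComplexMultiplication (IsCMTypeRealisation)
open Literature.AlgebraicTopology.SingularHomology
open Literature.NumberTheory.ComplexMultiplication
open Summit.HodgeConjecture.CorCM.Census.MultiFieldWeil

open scoped Classical

/-! ## §1 The defect law for realised tuples with a twin pair -/

section Realised

variable {I : Type} {r : ℕ} {Kf : I → Type} [∀ i, Field (Kf i)] [∀ i, NumberField (Kf i)] {i₀ : I} {is : Fin r → I} {n : Fin r → ℕ}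
  {e : ∀ m : Fin r, (Kf (is m) →+* ℂ) ≃ Fin (n m) × Bool} {τ : Kf i₀ →+* ℂ} {im : ∀ m : Fin r, Kf i₀ →+* Kf (is m)}
  (he_sign : ∀ (m : Fin r) (s : Kf (is m) →+* ℂ), (e m s).2 = true ↔ s.comp (im m) = τ)

include he_sign in
/-- **THE DEFECT LAW FOR REALISED TUPLES WITH A TWIN PAIR** (`CorCM/MultiFieldWeilTwinUnits` §3 for the realised tuples: PRIME relative degrees, proper non-empty position sets, a
twin pair `m₁ ≠ m₂` — one size `≥ 3`, diagonal realised tuples, `2`-transitive at `m₁`, singleton position sets `{p₁} ≠ {p₂}` —, realised tuples trivial on a unit transitive on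
every slot of another unit). [cite: MoonenZarhin1995Duke, Thm. 2.4] [cite: Shimura1998, §18.2 Lemma (i)] [cite: DixonMortimer1996, §1.6 and Thm. 1.6A; §2.1] -/
theorem exists_hasDefectsG_realisedTuples_of_twin (hpr : ∀ m, (n m).Prime) {m₁ m₂ : Fin r} (hm : m₁ ≠ m₂) (hn : n m₂ = n m₁) (h3 : 3 ≤ n m₁)
    (hdiag : ∀ π ∈ realisedTuples e τ, ∀ a : Fin (n m₂), Fin.cast hn (π m₂ a) = π m₁ (Fin.cast hn a))
    (h2t : ∀ a a' b b' : Fin (n m₁), a ≠ a' → b ≠ b' → ∃ π ∈ realisedTuples e τ, π m₁ a = b ∧ π m₁ a' = b')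
    (hstab : ∀ (m₀ m : Fin r), (if m₀ = m₂ then m₁ else m₀) ≠ (if m = m₂ then m₁ else m) → ∀ a a' : Fin (n m),
      ∃ ν ∈ realisedTuples e τ, (∀ m', (if m' = m₂ then m₁ else m') = (if m₀ = m₂ then m₁ else m₀) → ν m' = 1) ∧ ν m a = a')
    {P : ∀ m : Fin r, Finset (Fin (n m))} (hP0 : ∀ m, (P m).Nonempty) (hPn : ∀ m, (P m).card < n m)
    {p₁ : Fin (n m₁)} {p₂ : Fin (n m₂)} (hP₁ : P m₁ = {p₁}) (hP₂ : P m₂ = {p₂}) (hp : Fin.cast hn p₂ ≠ p₁)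
    (c : Fin r → ℕ) (hc : ∀ m, ((c m : ℕ) : ℤ) = (n m : ℤ) - 2 * (P m).card)
    {α : Type} (v : α → PtG n) (T : Finset α) (hT : ModelBalancedG P (realisedTuples e τ) v T) : ∃ t : Fin r → ℤ, HasDefectsG c v T t :=
  exists_hasDefectsG_of_twinStabiliserTransitive (fun _ hπ _ hπ' => mul_mem_realisedTuples e τ hπ hπ') (fun _ hπ => inv_mem_realisedTuples hπ)
    (realisedTuples_nonempty (e := e) he_sign) (fun m a b => transitive_realisedTuples (e := e) he_sign m a b) hm hn h3 hdiag h2t hstab hpr hP0 hPn hP₁ hP₂ hp c hc v T hT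

end Realised

/-! ## §2 The headline, frame form -/

section Headline

variable {I : Type} {r : ℕ} {Kf : I → Type} [∀ i, Field (Kf i)] [∀ i, NumberField (Kf i)] [∀ i, IsCMField (Kf i)]
  {i₀ : I} {is : Fin r → I} {n : Fin r → ℕ} {τ : Kf i₀ →+* ℂ}
  {A : Fin (r + 1) → AbelianVariety ℂ} {Φ : ∀ j : Fin (r + 1), CMType (Kf (mfSlots i₀ is j))}
  {ι : ∀ j, 𝓞 (Kf (mfSlots i₀ is j)) →+* End (A j)}
  {θ : ∀ j, Kf (mfSlots i₀ is j) →+* Module.End ℂ (complexBetti (A j).X 1)}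

/-- **HEADLINE (frame form) — PRIME RELATIVE DEGREES WITH A TWIN PAIR OF SLOTS, GIVEN THE SINGLE-SLOT WEIL SPACES.**  `k = Kf i₀` imaginary quadratic, `E = A 0 ⊨ (k; {τ})`
(`τ(δ) = i√d`), `B_m = A (m+1) ⊨ (K_m; Φ (m+1))` over CM fields `K_m ⊇ i_m(k)` of PRIME `n_m = [K_m : k]`, types read by frames `e m` at position sets `P m` of sizes `p_m`
(`0 < p_m`, `2 p_m ≤ n_m`); a TWIN PAIR `m₁ ≠ m₂` (one size `≥ 3`, realised tuples diagonal on the pair and `2`-transitive at `m₁`, `P_{m₁} = {p₁}`, `P_{m₂} = {p₂}`, `p₂ ≠ p₁`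
under the identification); the realised tuples trivial on each unit (the pair; the other slots) transitive on every slot of every other unit.  Then the Hodge conjecture holds for
EVERY product of copies `⨁_j A(κ j)` GIVEN the single-slot Weil spaces `hW m`.  `HC_CM` is NOT asserted. [cite: Pohlmann1968, Thm 1] [cite: MoonenZarhin1995Duke, Thm. 2.4]
[cite: Milne2020HodgeClassesAV, 1.2 (a) and Thm. 1] [cite: DixonMortimer1996, §1.6 and Thm. 1.6A; §2.1] -/
theorem hodgeConjectureFor_biproduct_comp_of_twin_frames (P : ∀ m : Fin r, Finset (Fin (n m))) (p : Fin r → ℕ)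
    (hcard : ∀ m, (P m).card = p m) (hpr : ∀ m, (n m).Prime) (hp0 : ∀ m, 0 < p m) (hpn : ∀ m, 2 * p m ≤ n m)
    {N : ℕ} (κ : Fin N → Fin (r + 1)) (h2 : Module.finrank ℚ (Kf i₀) = 2) (im : ∀ m : Fin r, Kf i₀ →+* Kf (is m))
    {δ : 𝓞 (Kf i₀)} {d : ℕ} (hτ : τ (δ : Kf i₀) = Complex.I * (Real.sqrt d : ℂ))
    (hA : ∀ j, IsCMTypeRealisation (Φ j) (A j) (ι j) (θ j))
    (e : ∀ m : Fin r, (Kf (is m) →+* ℂ) ≃ Fin (n m) × Bool)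
    (he_sign : ∀ (m : Fin r) (s : Kf (is m) →+* ℂ), (e m s).2 = true ↔ s.comp (im m) = τ)
    (he_conj : ∀ (m : Fin r) (s : Kf (is m) →+* ℂ), e m (ComplexEmbedding.conjugate s) = ((e m s).1, !(e m s).2))
    (hΨ : ∀ σ : Kf i₀ →+* ℂ, σ ∈ (Φ 0).1 ↔ σ = τ)
    (hΦ : ∀ (m : Fin r) (s : Kf (is m) →+* ℂ), s ∈ (Φ m.succ).1 ↔ (e m s).2 = decide ((e m s).1 ∈ P m))
    {m₁ m₂ : Fin r} (hm : m₁ ≠ m₂) (hn : n m₂ = n m₁) (h3 : 3 ≤ n m₁)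
    (hdiag : ∀ π ∈ realisedTuples e τ, ∀ a : Fin (n m₂), Fin.cast hn (π m₂ a) = π m₁ (Fin.cast hn a))
    (h2t : ∀ a a' b b' : Fin (n m₁), a ≠ a' → b ≠ b' → ∃ π ∈ realisedTuples e τ, π m₁ a = b ∧ π m₁ a' = b')
    (hstab : ∀ (m₀ m : Fin r), (if m₀ = m₂ then m₁ else m₀) ≠ (if m = m₂ then m₁ else m) → ∀ a a' : Fin (n m),
      ∃ ν ∈ realisedTuples e τ, (∀ m', (if m' = m₂ then m₁ else m') = (if m₀ = m₂ then m₁ else m₀) → ν m' = 1) ∧ ν m a = a')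
    {p₁ : Fin (n m₁)} {p₂ : Fin (n m₂)} (hP₁ : P m₁ = {p₁}) (hP₂ : P m₂ = {p₂}) (hp : Fin.cast hn p₂ ≠ p₁)
    (hW : ∀ m : Fin r, weilClassesOf (⨁ fun i => A (partSlots (n m - 2 * p m) m i))
      (biproduct.map fun i => ι (partSlots (n m - 2 * p m) m i) (δfam im δ (partSlots (n m - 2 * p m) m i))) (n m - p m) d ≤
      algebraicClasses (⨁ fun i => A (partSlots (n m - 2 * p m) m i)).X (n m - p m)) :
    HodgeConjectureFor (⨁ fun j => A (κ j)).dim (⨁ fun j => A (κ j)).X :=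
  hodgeConjectureFor_biproduct_comp_of_defectLawG (is := is) P (fun m => n m - 2 * p m) (fun m => n m - p m)
    (fun m => by have := hpn m; omega) (fun m => by have := hp0 m; have := hpn m; omega) κ h2 im hτ hA e he_sign he_conj hΨ hΦ
    (fun v T hT => exists_hasDefectsG_realisedTuples_of_twin (e := e) he_sign hpr hm hn h3 hdiag h2t hstab
      (fun m => Finset.card_pos.1 (by rw [hcard m]; exact hp0 m)) (fun m => by have := hpn m; have := hp0 m; rw [hcard m]; omega) hP₁ hP₂ hp
      (fun m => n m - 2 * p m) (cast_sub_two_mul_eq hcard hpn) v T hT) hW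

/-- **Dominated form.** [cite: MumfordAV1970, §19 Thm. 1 and p. 169] [cite: Pohlmann1968, Thm 1] -/
theorem hodgeConjectureFor_of_avDominatedBy_comp_of_twin_frames (P : ∀ m : Fin r, Finset (Fin (n m))) (p : Fin r → ℕ)
    (hcard : ∀ m, (P m).card = p m) (hpr : ∀ m, (n m).Prime) (hp0 : ∀ m, 0 < p m) (hpn : ∀ m, 2 * p m ≤ n m)
    {N : ℕ} (κ : Fin N → Fin (r + 1)) (h2 : Module.finrank ℚ (Kf i₀) = 2) (im : ∀ m : Fin r, Kf i₀ →+* Kf (is m))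
    {δ : 𝓞 (Kf i₀)} {d : ℕ} (hτ : τ (δ : Kf i₀) = Complex.I * (Real.sqrt d : ℂ))
    (hA : ∀ j, IsCMTypeRealisation (Φ j) (A j) (ι j) (θ j))
    (e : ∀ m : Fin r, (Kf (is m) →+* ℂ) ≃ Fin (n m) × Bool)
    (he_sign : ∀ (m : Fin r) (s : Kf (is m) →+* ℂ), (e m s).2 = true ↔ s.comp (im m) = τ)
    (he_conj : ∀ (m : Fin r) (s : Kf (is m) →+* ℂ), e m (ComplexEmbedding.conjugate s) = ((e m s).1, !(e m s).2))
    (hΨ : ∀ σ : Kf i₀ →+* ℂ, σ ∈ (Φ 0).1 ↔ σ = τ)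
    (hΦ : ∀ (m : Fin r) (s : Kf (is m) →+* ℂ), s ∈ (Φ m.succ).1 ↔ (e m s).2 = decide ((e m s).1 ∈ P m))
    {m₁ m₂ : Fin r} (hm : m₁ ≠ m₂) (hn : n m₂ = n m₁) (h3 : 3 ≤ n m₁)
    (hdiag : ∀ π ∈ realisedTuples e τ, ∀ a : Fin (n m₂), Fin.cast hn (π m₂ a) = π m₁ (Fin.cast hn a))
    (h2t : ∀ a a' b b' : Fin (n m₁), a ≠ a' → b ≠ b' → ∃ π ∈ realisedTuples e τ, π m₁ a = b ∧ π m₁ a' = b')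
    (hstab : ∀ (m₀ m : Fin r), (if m₀ = m₂ then m₁ else m₀) ≠ (if m = m₂ then m₁ else m) → ∀ a a' : Fin (n m),
      ∃ ν ∈ realisedTuples e τ, (∀ m', (if m' = m₂ then m₁ else m') = (if m₀ = m₂ then m₁ else m₀) → ν m' = 1) ∧ ν m a = a')
    {p₁ : Fin (n m₁)} {p₂ : Fin (n m₂)} (hP₁ : P m₁ = {p₁}) (hP₂ : P m₂ = {p₂}) (hp : Fin.cast hn p₂ ≠ p₁)
    (hW : ∀ m : Fin r, weilClassesOf (⨁ fun i => A (partSlots (n m - 2 * p m) m i))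
      (biproduct.map fun i => ι (partSlots (n m - 2 * p m) m i) (δfam im δ (partSlots (n m - 2 * p m) m i))) (n m - p m) d ≤
      algebraicClasses (⨁ fun i => A (partSlots (n m - 2 * p m) m i)).X (n m - p m))
    {X : AbelianVariety ℂ} (hX : Domination.AVDominatedBy X (⨁ fun j => A (κ j))) : HodgeConjectureFor X.dim X.X :=
  Domination.hodgeConjectureFor_of_avDominatedBy
    (hodgeConjectureFor_biproduct_comp_of_twin_frames P p hcard hpr hp0 hpn κ h2 im hτ hA e he_sign he_conj hΨ hΦ hm hn h3 hdiag h2t hstab hP₁ hP₂ hp hW) hX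

end Headline

end Summit.HodgeConjecture.CorCM.MultiFieldWeil

end
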